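import Literature.NumberTheory.Automorphic.U21LevelStrings      -- ★ p832119 (A-p14 (g23)): N3e-1 `finrank_weightVectors_level_le`
import HarnessLib

/-!
# `U(2,1)`: the joint highest weight vectors in the `𝔭`-filtration `F_N` of a `(𝔤, K)`-module are at most `dim W₀` in number

Topic `NumberTheory/Automorphic`; namespace `Literature.NumberTheory.Automorphic`.  THEOREMS ONLY (no `def`, no named fact, no instance, no notation, no
`sorry`).  Cell `hodgecm-mathlib`, F0∕P3, T1a arch line, road «V19 in-house for `U(2,1)`» (registered pay-down line
`Cruxes/H413/Lines/F0_T1a_V19KTypeGrowthPaydown.lean`, open stub `stub_N3 : LevelBound₂₁`), node **N3e-2** (seat A-p14 (g23); LEAD F0P3b-p01 (g2)).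

THE MATHEMATICS ([Varadarajan1989, §5.4 Thm. 22]; [BorelWallach2000, II §4.2]; [Humphreys1972, §7.2]).  `V` a `(𝔤, K)`-module of `U(2,1)` with scalar
Casimir; `W₀ ⊂ V` finite-dimensional, `K`-stable, inside ONE eigenspace of `z₀ = diag(i,i,0) ∈ 𝔷(𝔨)` (eigenvalue `ζ₀`); `F_N = Σ_{a+b ≤ N} M_{a,b}` the
`𝔭`-filtration (★ `upqPFiltration`, ★ `upqPFiltration_eq_iSup_upqLevel`); `e, f, h` the `𝔰𝔩₂`-triple of `𝔨_ℂ` and `z = ρ𝔤(z₀)` (★ N3c).  For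
`μ, ζ ∈ ℂ` let `X_{μ,ζ} := {v | e v = 0, h v = μ v, z v = ζ v}` (joint highest weight vectors of `K`-weight `(μ, ζ)`).  THEN
  **`dim (X_{μ,ζ} ∩ F_N) ≤ dim W₀` for every `N`** (`finrank_weightVectors_inf_upqPFiltration_le`).
PROOF.  §1 (linear algebra) inside `⊕_a U_a` with `U_a ⊆` distinct `z`-eigenspaces, a `z`-eigenvector of eigenvalue `ζ` lies in the single `U_a` of
eigenvalue `ζ` (independence of eigenspaces).  §2 Along `F_k ⊂ F_{k+1}`: `dim (X ∩ F_{k+1}) ≤ dim (X ∩ F_k) + dim (image in V ⧸ F_k)` (rank–nullity);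
`F_{k+1} ⧸ F_k = Σ_{a+b=k+1} [M_{a,b}]` with `[M_{a,b}] ⊆` the `z̄`-eigenspace `ζ₀ + i(a−b)` (★ `upqLevel_le_eigenspace`; distinct for distinct `a`), so the
image lies in the `ē`-killed `h̄`-eigenvectors of the one `[M_{a,b}]` with `ζ₀ + i(a−b) = ζ` — of dimension `≤ dim (W₀)_{μ−(k+1)}` by ★ N3e-1
`finrank_weightVectors_level_le` — or vanishes.  §3 Summing, `dim (X ∩ F_N) ≤ Σ_{k ≤ N} dim (W₀)_{μ−k} = dim (⊕_{k ≤ N} (W₀)_{μ−k}) ≤ dim W₀` (distinct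
`h`-eigenvalues `μ − k`).

HONEST LABEL: kernel theorems about abstract `(𝔤, K)`-modules of `U(2,1)`; nothing printed about HC_CM is discharged here.  HC_CM is proved only modulo
the 2 remaining named inputs (hLiu418, h413) until rung 0 closes.

## References
* V. S. Varadarajan, *An Introduction to Harmonic Analysis on Semisimple Lie Groups* (1989), §5.4 Thm. 22. [Varadarajan1989]
* A. Borel, N. Wallach, *Continuous Cohomology, Discrete Subgroups, and Representations of Reductive Groups*, 2nd ed. (2000), II §4.2. [BorelWallach2000]
* J. E. Humphreys, *Introduction to Lie Algebras and Representation Theory*, GTM 9 (1972), §7.2. [Humphreys1972]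
-/

-- Mathlib idiom (as in ★ `GKModules` and every `(𝔤, K)` file of the tree): the commutator bracket on `Module.End ℂ V` and on matrices, needed to
-- MENTION `ρ𝔤 : (uFormGroup α β).lie →ₗ⁅ℝ⁆ Module.End ℂ V` (`LieRing.ofAssociativeRing` is a `def` in Mathlib, not a global instance).
attribute [local instance 100] LieRing.ofAssociativeRing

set_option autoImplicit false

open scoped MatrixGroups Matrix ComplexConjugate

noncomputable section

namespace Literature.NumberTheory.Automorphic

open Literature.RepresentationTheory Literature.RepresentationTheory.BorelWallach2000 Literature.RepresentationTheory.KonnoKonno2007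
open Literature.Algebra.Lie Module

/-! ## §1 Linear algebra: eigenvectors inside a sum of pieces of distinct eigenspaces -/

/-- Inside `Σ_{i∈s} U_i` with `U_i ⊆` the `ν_i`-eigenspace of `T`, an eigenvector of `T` whose eigenvalue `ζ` is none of the `ν_i` vanishes. [cite: Humphreys1972, §6.4 (Jordan–Chevalley), §7.2] -/
theorem eq_zero_of_mem_biSup_of_mem_eigenspace {M : Type*} [AddCommGroup M] [Module ℂ M] (T : Module.End ℂ M) {ι : Type*} (s : Finset ι)
    (U : ι → Submodule ℂ M) (ν : ι → ℂ) (hU : ∀ i ∈ s, U i ≤ T.eigenspace (ν i)) {ζ : ℂ} (hζ : ∀ i ∈ s, ν i ≠ ζ) {x : M}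
    (hx : x ∈ ⨆ i ∈ s, U i) (hTx : x ∈ T.eigenspace ζ) : x = 0 := by
  have hle : (⨆ i ∈ s, U i) ≤ ⨆ ν' ∈ {ν' : ℂ | ν' ≠ ζ}, T.eigenspace ν' :=
    iSup₂_le fun i hi => (hU i hi).trans (le_biSup (fun ν' => T.eigenspace ν') (show ν i ∈ {ν' : ℂ | ν' ≠ ζ} from hζ i hi))
  have hdis := (Module.End.eigenspaces_iSupIndep T).disjoint_biSup (x := ζ) (y := {ν' : ℂ | ν' ≠ ζ}) (by simp)
  exact (Submodule.disjoint_def.mp hdis) x hTx (hle hx)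

/-- Inside `Σ_{i∈s} U_i` with `U_i ⊆` the `ν_i`-eigenspace of `T` and the `ν_i` distinct, an eigenvector of `T` of eigenvalue `ν_{i₀}` lies in `U_{i₀}`.
[cite: Humphreys1972, §6.4 (Jordan–Chevalley), §7.2] -/
theorem mem_of_mem_biSup_of_mem_eigenspace {M : Type*} [AddCommGroup M] [Module ℂ M] (T : Module.End ℂ M) {ι : Type*} (s : Finset ι)
    (U : ι → Submodule ℂ M) (ν : ι → ℂ) (hU : ∀ i ∈ s, U i ≤ T.eigenspace (ν i)) {i₀ : ι} (hi₀ : i₀ ∈ s)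
    (hν : ∀ i ∈ s, i ≠ i₀ → ν i ≠ ν i₀) {x : M} (hx : x ∈ ⨆ i ∈ s, U i) (hTx : x ∈ T.eigenspace (ν i₀)) : x ∈ U i₀ := by
  classical
  have hle : (⨆ i ∈ s, U i) ≤ U i₀ ⊔ ⨆ i ∈ s.erase i₀, U i := by
    refine iSup₂_le fun i hi => ?_
    by_cases h : i = i₀
    · subst h; exact le_sup_left
    · exact (le_biSup U (Finset.mem_erase.mpr ⟨h, hi⟩)).trans le_sup_right
  obtain ⟨u, hu, p, hp, rfl⟩ := Submodule.mem_sup.mp (hle hx)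
  have hp' : p ∈ T.eigenspace (ν i₀) := by
    have := Submodule.sub_mem _ hTx (hU i₀ hi₀ hu)
    rwa [add_sub_cancel_left] at this
  have hp0 : p = 0 :=
    eq_zero_of_mem_biSup_of_mem_eigenspace T (s.erase i₀) U ν (fun i hi => hU i (Finset.mem_of_mem_erase hi))
      (fun i hi => hν i (Finset.mem_of_mem_erase hi) (Finset.ne_of_mem_erase hi)) hp hp'
  rw [hp0, add_zero]
  exact hu

/-- A sum of eigenspaces of `T` for finitely many eigenvalues `μ − k`, `k ≤ N`, has dimension `Σ_k dim` (independence) and hence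
`Σ_{k ≤ N} dim M_{μ−k} ≤ dim M`. [cite: Humphreys1972, §6.4 (Jordan–Chevalley), §7.2] -/
theorem sum_finrank_eigenspace_sub_le {M : Type*} [AddCommGroup M] [Module ℂ M] [FiniteDimensional ℂ M] (T : Module.End ℂ M) (μ : ℂ) (N : ℕ) :
    ∑ k ∈ Finset.range (N + 1), finrank ℂ ↥(T.eigenspace (μ - k)) ≤ finrank ℂ M := by
  -- `Σ_{k ≤ N} dim M_{μ-k} = dim (⨆_{k ≤ N} M_{μ-k})` by induction, using disjointness from independence
  suffices h : ∀ N : ℕ, ∑ k ∈ Finset.range (N + 1), finrank ℂ ↥(T.eigenspace (μ - k)) =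
      finrank ℂ ↥(⨆ k ∈ Finset.range (N + 1), T.eigenspace (μ - k)) by
    rw [h N]; exact Submodule.finrank_le _
  intro N
  induction N with
  | zero => rw [Finset.sum_range_one, Finset.range_one, Finset.iSup_singleton, Nat.cast_zero]
  | succ N ih =>
    rw [Finset.sum_range_succ, ih]
    have hsplit : (⨆ k ∈ Finset.range (N + 1 + 1), T.eigenspace (μ - k)) =
        (⨆ k ∈ Finset.range (N + 1), T.eigenspace (μ - k)) ⊔ T.eigenspace (μ - ((N + 1 : ℕ) : ℂ)) := by
      rw [Finset.range_add_one (n := N + 1), Finset.iSup_insert, sup_comm]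
    have hdis : Disjoint (T.eigenspace (μ - ((N + 1 : ℕ) : ℂ))) (⨆ k ∈ Finset.range (N + 1), T.eigenspace (μ - k)) := by
      have hle : (⨆ k ∈ Finset.range (N + 1), T.eigenspace (μ - k)) ≤ ⨆ ν' ∈ {ν' : ℂ | ν' ≠ μ - ((N + 1 : ℕ) : ℂ)}, T.eigenspace ν' := by
        refine iSup₂_le fun k hk => le_biSup (fun ν' => T.eigenspace ν') (?_ : μ - (k : ℂ) ∈ {ν' : ℂ | ν' ≠ μ - ((N + 1 : ℕ) : ℂ)})
        rw [Finset.mem_range] at hk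
        simp only [Set.mem_setOf_eq, ne_eq, sub_right_inj, Nat.cast_inj]
        omega
      exact ((Module.End.eigenspaces_iSupIndep T).disjoint_biSup (x := μ - ((N + 1 : ℕ) : ℂ)) (y := {ν' : ℂ | ν' ≠ μ - ((N + 1 : ℕ) : ℂ)})
        (by simp)).mono_right hle
    rw [hsplit, ← Submodule.finrank_sup_add_finrank_inf_eq, disjoint_iff.mp hdis.symm, finrank_bot, add_zero]

/-! ## §2 The filtration step -/

variable {V : Type*} [AddCommGroup V] [Module ℂ V]
  (ρK : Representation ℂ (uFormGroup (Fin 2) (Fin 1)).maximalCompact V) {ρ𝔤 : (uFormGroup (Fin 2) (Fin 1)).lie →ₗ⁅ℝ⁆ Module.End ℂ V}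

/-- `𝔨` preserves every `K`-stable subspace of a `(𝔤, K)`-module; in particular so do `e`, `f`, `h` (block-diagonal elements of `ρ_ℂ(𝔨_ℂ)`).
[cite: BorelWallach2000, 0 §2.5] -/
theorem u21_kInLie_apply_mem_of_K_stable (hV : IsGKModule (uFormGroup (Fin 2) (Fin 1)) ρK ρ𝔤) {U : Submodule ℂ V}
    (hU : ∀ (k : (uFormGroup (Fin 2) (Fin 1)).maximalCompact), ∀ u ∈ U, ρK k u ∈ U) :
    ∀ Y ∈ (uFormGroup (Fin 2) (Fin 1)).kInLie, ∀ u ∈ U, ρ𝔤 Y u ∈ U :=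
  fun _ hY _ hu => apply_mem_of_K_stable_of_mem_kInLie ρK hV hU hY hu

/-- **THE FILTRATION STEP: `dim (X_{μ,ζ} ∩ F_{k+1}) ≤ dim (X_{μ,ζ} ∩ F_k) + dim (W₀)_{μ−(k+1)}`.**
[cite: Varadarajan1989, §5.4 Thm. 22] [cite: BorelWallach2000, II §4.2] -/
theorem finrank_weightVectors_inf_upqPFiltration_succ_le (hV : IsGKModule (uFormGroup (Fin 2) (Fin 1)) ρK ρ𝔤) {c : ℂ}
    (hC : upqCasimirOp ρ𝔤 = algebraMap ℂ (Module.End ℂ V) c) {W₀ : Submodule ℂ V} [FiniteDimensional ℂ W₀]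
    (hW₀ : ∀ (k : (uFormGroup (Fin 2) (Fin 1)).maximalCompact), ∀ w ∈ W₀, ρK k w ∈ W₀) {ζ₀ : ℂ}
    (hζ₀ : W₀ ≤ (ρ𝔤 (upqZ0 (Fin 2) (Fin 1))).eigenspace ζ₀) (hW₀h : ∀ x ∈ W₀, u21h ρ𝔤 x ∈ W₀) (μ ζ : ℂ) (k : ℕ) :
    finrank ℂ ↥(LinearMap.ker (u21e ρ𝔤) ⊓ (u21h ρ𝔤).eigenspace μ ⊓ (ρ𝔤 (upqZ0 (Fin 2) (Fin 1))).eigenspace ζ ⊓ upqPFiltration ρ𝔤 W₀ (k + 1)) ≤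
      finrank ℂ ↥(LinearMap.ker (u21e ρ𝔤) ⊓ (u21h ρ𝔤).eigenspace μ ⊓ (ρ𝔤 (upqZ0 (Fin 2) (Fin 1))).eigenspace ζ ⊓ upqPFiltration ρ𝔤 W₀ k) +
        finrank ℂ ↥(Module.End.eigenspace ((u21h ρ𝔤).restrict hW₀h) (μ - ((k + 1 : ℕ) : ℂ))) := by
  set X : Submodule ℂ V := LinearMap.ker (u21e ρ𝔤) ⊓ (u21h ρ𝔤).eigenspace μ ⊓ (ρ𝔤 (upqZ0 (Fin 2) (Fin 1))).eigenspace ζ with hX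
  set F : ℕ → Submodule ℂ V := upqPFiltration ρ𝔤 W₀ with hF
  haveI : ∀ m, FiniteDimensional ℂ ↥(F m) := fun m => finiteDimensional_upqPFiltration (ρ𝔤 := ρ𝔤) W₀ m
  haveI hXF : ∀ m, FiniteDimensional ℂ ↥(X ⊓ F m) := fun m => Submodule.finiteDimensional_inf_right _ _
  -- stabilities of `F k`
  have hFK : ∀ m, ∀ (g : (uFormGroup (Fin 2) (Fin 1)).maximalCompact), ∀ u ∈ F m, ρK g u ∈ F m := fun m g u hu =>
    apply_mem_upqPFiltration_of_K_stable ρK hV hW₀ m g hu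
  have hFk : ∀ Y ∈ (uFormGroup (Fin 2) (Fin 1)).kInLie, ∀ u ∈ F k, ρ𝔤 Y u ∈ F k := u21_kInLie_apply_mem_of_K_stable ρK hV (hFK k)
  have hLe : F k ≤ (F k).comap (u21e ρ𝔤) := fun v hv => u21e_apply_mem ρ𝔤 hFk hv
  have hLf : F k ≤ (F k).comap (u21f ρ𝔤) := fun v hv => u21f_apply_mem ρ𝔤 hFk hv
  have hLh : F k ≤ (F k).comap (u21h ρ𝔤) := fun v hv => u21h_apply_mem ρ𝔤 hFk hv
  have hLz : F k ≤ (F k).comap (ρ𝔤 (upqZ0 (Fin 2) (Fin 1))) := fun v hv => hFk _ upqZ0_mem_kInLie v hv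
  have hW₀k : ∀ Y ∈ (uFormGroup (Fin 2) (Fin 1)).kInLie, ∀ u ∈ W₀, ρ𝔤 Y u ∈ W₀ := u21_kInLie_apply_mem_of_K_stable ρK hV hW₀
  have hW₀e : ∀ x ∈ W₀, u21e ρ𝔤 x ∈ W₀ := fun x hx => u21e_apply_mem ρ𝔤 hW₀k hx
  have hW₀f : ∀ x ∈ W₀, u21f ρ𝔤 x ∈ W₀ := fun x hx => u21f_apply_mem ρ𝔤 hW₀k hx
  -- the projection `π : X ∩ F_{k+1} → V ⧸ F_k`
  let π : ↥(X ⊓ F (k + 1)) →ₗ[ℂ] V ⧸ F k := (F k).mkQ ∘ₗ (X ⊓ F (k + 1)).subtype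
  have hrn := LinearMap.finrank_range_add_finrank_ker π
  -- the kernel injects into `X ∩ F_k`
  have hker : finrank ℂ ↥(LinearMap.ker π) ≤ finrank ℂ ↥(X ⊓ F k) := by
    let ι : ↥(LinearMap.ker π) →ₗ[ℂ] ↥(X ⊓ F k) :=
      { toFun := fun v => ⟨(v : ↥(X ⊓ F (k + 1))), ⟨v.1.2.1, by
            have hv := v.2
            rw [LinearMap.mem_ker] at hv
            exact (Submodule.Quotient.mk_eq_zero (F k)).mp hv⟩⟩
        map_add' := fun _ _ => rfl
        map_smul' := fun _ _ => rfl }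
    refine LinearMap.finrank_le_finrank_of_injective (f := ι) fun v w hvw => ?_
    apply Subtype.ext; apply Subtype.ext
    exact congrArg (fun y : ↥(X ⊓ F k) => (y : V)) hvw
  -- the pieces `U_a = [M_{a, k+1-a}]` of `F_{k+1} ⧸ F_k` and their `z̄`-eigenvalues
  set zbar := (F k).mapQ (F k) (ρ𝔤 (upqZ0 (Fin 2) (Fin 1))) hLz with hzbar
  set U : ℕ → Submodule ℂ (V ⧸ F k) := fun a => (upqLevel ρ𝔤 W₀ a (k + 1 - a)).map (F k).mkQ with hU
  set ν : ℕ → ℂ := fun a => ζ₀ + Complex.I * ((a : ℂ) - ((k + 1 - a : ℕ) : ℂ)) with hν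
  have hUν : ∀ a ∈ Finset.range (k + 2), U a ≤ Module.End.eigenspace zbar (ν a) := by
    intro a _ x hx
    obtain ⟨v, hv, rfl⟩ := Submodule.mem_map.mp hx
    rw [Module.End.mem_eigenspace_iff, Submodule.mkQ_apply, hzbar, Submodule.mapQ_apply, ← Submodule.Quotient.mk_smul]
    congr 1
    exact Module.End.mem_eigenspace_iff.mp (upqLevel_le_eigenspace hζ₀ a (k + 1 - a) hv)
  have hνinj : ∀ a ∈ Finset.range (k + 2), ∀ a' ∈ Finset.range (k + 2), ν a = ν a' → a = a' := by
    intro a ha a' ha' h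
    rw [Finset.mem_range] at ha ha'
    simp only [hν, add_right_inj, mul_eq_mul_left_iff, Complex.I_ne_zero, or_false] at h
    have h' : ((a : ℂ) - ((k + 1 - a : ℕ) : ℂ)).re = ((a' : ℂ) - ((k + 1 - a' : ℕ) : ℂ)).re := by rw [h]
    simp only [Complex.sub_re, Complex.natCast_re] at h'
    have e1 : ((k + 1 - a : ℕ) : ℝ) = (k : ℝ) + 1 - a := by rw [Nat.cast_sub (by omega)]; push_cast; ring
    have e2 : ((k + 1 - a' : ℕ) : ℝ) = (k : ℝ) + 1 - a' := by rw [Nat.cast_sub (by omega)]; push_cast; ring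
    rw [e1, e2] at h'
    exact_mod_cast (by linarith : (a : ℝ) = a')
  -- `[F_{k+1}] ⊆ Σ_{a ≤ k+1} U_a`
  have hFU : (F (k + 1)).map (F k).mkQ ≤ ⨆ a ∈ Finset.range (k + 2), U a := by
    have hF1 : F (k + 1) = ⨆ (a : ℕ) (b : ℕ) (_ : a + b ≤ k + 1), upqLevel ρ𝔤 W₀ a b := upqPFiltration_eq_iSup_upqLevel ρK hV hW₀ (k + 1)
    rw [Submodule.map_le_iff_le_comap, hF1]
    refine iSup_le fun a => iSup_le fun b => iSup_le fun hab => ?_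
    rw [← Submodule.map_le_iff_le_comap]
    rcases Nat.lt_or_ge (a + b) (k + 1) with hlt | hge
    · -- lower levels die in the quotient
      have hle : upqLevel ρ𝔤 W₀ a b ≤ F k := (upqLevel_le_upqPFiltration W₀ a b).trans (monotone_upqPFiltration ρ𝔤 W₀ (by omega))
      intro x hx
      obtain ⟨v, hv, rfl⟩ := Submodule.mem_map.mp hx
      rw [Submodule.mkQ_apply, (Submodule.Quotient.mk_eq_zero (F k)).mpr (hle hv)]
      exact Submodule.zero_mem _
    · have hb : b = k + 1 - a := by omega
      subst hb
      exact le_biSup U (Finset.mem_range.mpr (by omega))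
  -- the range of `π` lies in the weight vectors of the one piece with `ν a₀ = ζ` (or vanishes)
  have hrange_mem : ∀ y ∈ LinearMap.range π, y ∈ LinearMap.ker ((F k).mapQ (F k) (u21e ρ𝔤) hLe) ⊓ Module.End.eigenspace ((F k).mapQ (F k) (u21h ρ𝔤) hLh) μ ∧
      y ∈ Module.End.eigenspace zbar ζ ∧ y ∈ ⨆ a ∈ Finset.range (k + 2), U a := by
    rintro _ ⟨v, rfl⟩
    obtain ⟨⟨⟨hve, hvh⟩, hvz⟩, hvF⟩ := v.2
    refine ⟨Submodule.mem_inf.mpr ⟨?_, ?_⟩, ?_, hFU ⟨v, hvF, rfl⟩⟩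
    · rw [LinearMap.mem_ker, LinearMap.comp_apply, Submodule.subtype_apply, Submodule.mkQ_apply, Submodule.mapQ_apply, LinearMap.mem_ker.mp hve,
        Submodule.Quotient.mk_zero]
    · rw [Module.End.mem_eigenspace_iff, LinearMap.comp_apply, Submodule.subtype_apply, Submodule.mkQ_apply, Submodule.mapQ_apply,
        Module.End.mem_eigenspace_iff.mp hvh, Submodule.Quotient.mk_smul]
    · rw [Module.End.mem_eigenspace_iff, LinearMap.comp_apply, Submodule.subtype_apply, Submodule.mkQ_apply, hzbar, Submodule.mapQ_apply,
        Module.End.mem_eigenspace_iff.mp hvz, Submodule.Quotient.mk_smul]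
  have hrange : finrank ℂ ↥(LinearMap.range π) ≤ finrank ℂ ↥(Module.End.eigenspace ((u21h ρ𝔤).restrict hW₀h) (μ - ((k + 1 : ℕ) : ℂ))) := by
    by_cases hζ : ∃ a₀ ∈ Finset.range (k + 2), ν a₀ = ζ
    · obtain ⟨a₀, ha₀, hζa₀⟩ := hζ
      have hle : LinearMap.range π ≤ LinearMap.ker ((F k).mapQ (F k) (u21e ρ𝔤) hLe) ⊓ Module.End.eigenspace ((F k).mapQ (F k) (u21h ρ𝔤) hLh) μ ⊓ U a₀ := by
        intro y hy
        obtain ⟨h1, h2, h3⟩ := hrange_mem y hy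
        refine ⟨h1, mem_of_mem_biSup_of_mem_eigenspace zbar (Finset.range (k + 2)) U ν hUν ha₀ (fun a ha hne heq => hne (hνinj a ha a₀ ha₀ heq)) h3 ?_⟩
        rw [hζa₀]; exact h2
      haveI : FiniteDimensional ℂ ↥(upqLevel ρ𝔤 W₀ a₀ (k + 1 - a₀)) := finiteDimensional_upqLevel W₀ a₀ (k + 1 - a₀)
      haveI : FiniteDimensional ℂ ↥(LinearMap.ker ((F k).mapQ (F k) (u21e ρ𝔤) hLe) ⊓ Module.End.eigenspace ((F k).mapQ (F k) (u21h ρ𝔤) hLh) μ ⊓ U a₀) :=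
        Submodule.finiteDimensional_inf_right _ _
      refine (Submodule.finrank_mono hle).trans ?_
      have ha₀' := Finset.mem_range.mp ha₀
      have hL : upqLevel ρ𝔤 W₀ (a₀ - 1) (k + 1 - a₀ - 1) ≤ F k :=
        (upqLevel_le_upqPFiltration W₀ _ _).trans (monotone_upqPFiltration ρ𝔤 W₀ (by omega))
      have h := finrank_weightVectors_level_le ρK (a := a₀) (b := k + 1 - a₀) (L' := F k) hV hC hW₀ hW₀e hW₀f hW₀h hL hLe hLf hLh μ
      rwa [show a₀ + (k + 1 - a₀) = k + 1 by omega] at h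
    · simp only [not_exists, not_and] at hζ
      have h0 : LinearMap.range π = ⊥ := by
        rw [Submodule.eq_bot_iff]
        intro y hy
        obtain ⟨_, h2, h3⟩ := hrange_mem y hy
        exact eq_zero_of_mem_biSup_of_mem_eigenspace zbar (Finset.range (k + 2)) U ν hUν hζ h3 h2
      rw [h0, finrank_bot]
      exact Nat.zero_le _
  calc finrank ℂ ↥(X ⊓ F (k + 1)) = finrank ℂ ↥(LinearMap.range π) + finrank ℂ ↥(LinearMap.ker π) := hrn.symm
    _ ≤ finrank ℂ ↥(Module.End.eigenspace ((u21h ρ𝔤).restrict hW₀h) (μ - ((k + 1 : ℕ) : ℂ))) + finrank ℂ ↥(X ⊓ F k) := Nat.add_le_add hrange hker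
    _ = _ := Nat.add_comm _ _

/-! ## §3 The bound -/

/-- The base: `dim (X_{μ,ζ} ∩ F_0) ≤ dim (W₀)_μ` (`F_0 = W₀`). [cite: Varadarajan1989, §5.4] -/
theorem finrank_weightVectors_inf_upqPFiltration_zero_le {W₀ : Submodule ℂ V} [FiniteDimensional ℂ W₀] (hW₀h : ∀ x ∈ W₀, u21h ρ𝔤 x ∈ W₀) (μ ζ : ℂ) :
    finrank ℂ ↥(LinearMap.ker (u21e ρ𝔤) ⊓ (u21h ρ𝔤).eigenspace μ ⊓ (ρ𝔤 (upqZ0 (Fin 2) (Fin 1))).eigenspace ζ ⊓ upqPFiltration ρ𝔤 W₀ 0) ≤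
      finrank ℂ ↥(Module.End.eigenspace ((u21h ρ𝔤).restrict hW₀h) (μ - ((0 : ℕ) : ℂ))) := by
  let ι : ↥(LinearMap.ker (u21e ρ𝔤) ⊓ (u21h ρ𝔤).eigenspace μ ⊓ (ρ𝔤 (upqZ0 (Fin 2) (Fin 1))).eigenspace ζ ⊓ upqPFiltration ρ𝔤 W₀ 0) →ₗ[ℂ]
      ↥(Module.End.eigenspace ((u21h ρ𝔤).restrict hW₀h) (μ - ((0 : ℕ) : ℂ))) :=
    { toFun := fun v => ⟨⟨(v : V), by simpa [upqPFiltration_zero] using v.2.2⟩, by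
          rw [Module.End.mem_eigenspace_iff, Nat.cast_zero, sub_zero]
          apply Subtype.ext
          rw [LinearMap.restrict_apply, Submodule.coe_mk, Submodule.coe_smul]
          exact Module.End.mem_eigenspace_iff.mp v.2.1.1.2⟩
      map_add' := fun _ _ => rfl
      map_smul' := fun _ _ => rfl }
  refine LinearMap.finrank_le_finrank_of_injective (f := ι) fun v w hvw => ?_
  apply Subtype.ext
  exact congrArg (fun y : ↥(Module.End.eigenspace ((u21h ρ𝔤).restrict hW₀h) (μ - ((0 : ℕ) : ℂ))) => ((y : W₀) : V)) hvw

/-- **THE BOUND: `dim (X_{μ,ζ} ∩ F_N) ≤ Σ_{k ≤ N} dim (W₀)_{μ−k} ≤ dim W₀`** — in a `(𝔤, K)`-module of `U(2,1)` with scalar Casimir, the joint highest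
weight vectors of `K`-weight `(μ, ζ)` (`e v = 0`, `h v = μ v`, `z v = ζ v`) inside the `𝔭`-filtration `F_N` generated by a finite-dimensional `K`-stable
`W₀` lying in one `z`-eigenspace are at most `dim W₀` in number, uniformly in `N`, `μ`, `ζ`.
[cite: Varadarajan1989, §5.4 Thm. 22] [cite: BorelWallach2000, II §4.2] [cite: Humphreys1972, §7.2] -/
theorem finrank_weightVectors_inf_upqPFiltration_le (hV : IsGKModule (uFormGroup (Fin 2) (Fin 1)) ρK ρ𝔤) {c : ℂ}
    (hC : upqCasimirOp ρ𝔤 = algebraMap ℂ (Module.End ℂ V) c) {W₀ : Submodule ℂ V} [FiniteDimensional ℂ W₀]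
    (hW₀ : ∀ (k : (uFormGroup (Fin 2) (Fin 1)).maximalCompact), ∀ w ∈ W₀, ρK k w ∈ W₀) {ζ₀ : ℂ}
    (hζ₀ : W₀ ≤ (ρ𝔤 (upqZ0 (Fin 2) (Fin 1))).eigenspace ζ₀) (μ ζ : ℂ) (N : ℕ) :
    finrank ℂ ↥(LinearMap.ker (u21e ρ𝔤) ⊓ (u21h ρ𝔤).eigenspace μ ⊓ (ρ𝔤 (upqZ0 (Fin 2) (Fin 1))).eigenspace ζ ⊓ upqPFiltration ρ𝔤 W₀ N) ≤
      finrank ℂ ↥W₀ := by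
  have hW₀h : ∀ x ∈ W₀, u21h ρ𝔤 x ∈ W₀ := fun x hx => u21h_apply_mem ρ𝔤 (u21_kInLie_apply_mem_of_K_stable ρK hV hW₀) hx
  have hmain : ∀ N : ℕ, finrank ℂ ↥(LinearMap.ker (u21e ρ𝔤) ⊓ (u21h ρ𝔤).eigenspace μ ⊓ (ρ𝔤 (upqZ0 (Fin 2) (Fin 1))).eigenspace ζ ⊓ upqPFiltration ρ𝔤 W₀ N) ≤
      ∑ k ∈ Finset.range (N + 1), finrank ℂ ↥(Module.End.eigenspace ((u21h ρ𝔤).restrict hW₀h) (μ - k)) := by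
    intro N
    induction N with
    | zero => simpa using finrank_weightVectors_inf_upqPFiltration_zero_le (ρ𝔤 := ρ𝔤) hW₀h μ ζ
    | succ N ih =>
      rw [Finset.sum_range_succ]
      exact (finrank_weightVectors_inf_upqPFiltration_succ_le ρK hV hC hW₀ hζ₀ hW₀h μ ζ N).trans (Nat.add_le_add_right ih _)
  exact (hmain N).trans ((sum_finrank_eigenspace_sub_le ((u21h ρ𝔤).restrict hW₀h) μ N).trans (le_of_eq (by rfl)))

end Literature.NumberTheory.Automorphic

end
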